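import Mathlib.Topology.Algebra.InfiniteSum.Constructions
import Mathlib.Analysis.Complex.Basic
import Mathlib.Data.Set.Card
import Mathlib.Logic.Denumerable
import HarnessLib

/-!
# Enumerations with multiplicity (helper for `WeilAdversary.AdversaryTransfer`,
stmt-RiemannHypothesis-11224, `--supports`)

Pure combinatorics / summation bookkeeping, no zeta: a countably infinite set `S` with a
multiplicity function `m ≥ 1` on `S` admits an enumeration `ρ : ℕ → S` listing every `x ∈ S`
exactly `m x` times, in the sense that
* counting: for every `t` with `S ∩ t` finite, `{n | ρ n ∈ t}` is finite of cardinality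
  `∑_{x ∈ S ∩ t} m x`;
* summation: for every `f : α → ℂ` with `∑ₙ f(ρ n)` summable,
  `∑_{x ∈ S} m x · f x = ∑ₙ f(ρ n)` (as a `HasSum` over the subtype `S`).
(Index set `{(x, j) | x ∈ S, j < m x} ⊆ α × ℕ`, enumerated by `Denumerable.eqv`; the summation
clause is `HasSum.prod_fiberwise` on the indicator.)  Used to feed the TRUE non-trivial zeros of `ζ`,
with multiplicity, to the adversary of route `WeilAdversary`.  Nothing here bears on the truth of RH.
-/

-- `Summit.RiemannHypothesis.RiemannHypothesis.…` repeats a component by the tree's layout (D-0017).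
set_option linter.dupNamespace false

noncomputable section

open Set

namespace Summit.RiemannHypothesis.RiemannHypothesis.Theorems.WeilAdversary

/-- **Enumeration with multiplicity.** Let `S ⊆ α` be countable and infinite and `m : α → ℕ` with
`m x ≥ 1` on `S`. There is `ρ : ℕ → α` with values in `S` such that (i) for every `t ⊆ α` with
`S ∩ t` finite, `{n | ρ n ∈ t}` is finite and `#{n | ρ n ∈ t} = ∑_{x ∈ S ∩ t} m x`, and (ii) for every
`f : α → ℂ` with `n ↦ f (ρ n)` summable, `HasSum (fun x : S ↦ m x · f x) (∑' n, f (ρ n))`. -/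
theorem exists_enum_with_multiplicity {α : Type*} {S : Set α} (hSc : S.Countable)
    (hSi : S.Infinite) (m : α → ℕ) (hm : ∀ x ∈ S, 1 ≤ m x) :
    ∃ ρ : ℕ → α, (∀ n, ρ n ∈ S) ∧
      (∀ t : Set α, (S ∩ t).Finite →
        {n | ρ n ∈ t}.Finite ∧ {n | ρ n ∈ t}.ncard = ∑ᶠ x ∈ S ∩ t, m x) ∧
      (∀ f : α → ℂ, Summable (fun n ↦ f (ρ n)) →
        HasSum (fun x : S ↦ (m x : ℂ) * f x) (∑' n, f (ρ n))) := by
  classical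
  -- the index set: pairs `(x, j)` with `x ∈ S`, `j < m x`
  set I : Set (α × ℕ) := {p | p.1 ∈ S ∧ p.2 < m p.1} with hI_def
  have hsub : I ⊆ S ×ˢ (Set.univ : Set ℕ) := fun p hp ↦ Set.mem_prod.2 ⟨hp.1, Set.mem_univ _⟩
  have hIc : I.Countable :=
    (hSc.prod (Set.countable_univ : (Set.univ : Set ℕ).Countable)).mono hsub
  have hIi : I.Infinite := by
    have hinj : Set.InjOn (fun x : α ↦ (x, 0)) S := fun x _ y _ h ↦ (Prod.ext_iff.1 h).1
    have hmaps : Set.MapsTo (fun x : α ↦ (x, 0)) S I := fun x hx ↦ ⟨hx, hm x hx⟩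
    exact Set.infinite_of_injOn_mapsTo hinj hmaps hSi
  haveI : Countable I := hIc.to_subtype
  haveI : Infinite I := hIi.to_subtype
  haveI : Encodable I := Encodable.ofCountable I
  haveI : Denumerable I := Denumerable.ofEncodableOfInfinite I
  set e : ℕ ≃ I := (Denumerable.eqv I).symm with he
  refine ⟨fun n ↦ (e n).1.1, fun n ↦ (e n).2.1, ?_, ?_⟩
  · -- (i) counting
    intro t ht
    set A : Set I := {i | i.1.1 ∈ t} with hA_def
    set BF : Finset (α × ℕ) := ht.toFinset.biUnion fun x ↦ ({x} : Finset α) ×ˢ Finset.range (m x)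
      with hBF_def
    have hmemBF : ∀ p : α × ℕ, p ∈ BF ↔ p.1 ∈ S ∩ t ∧ p.2 < m p.1 := by
      intro p
      rw [hBF_def, Finset.mem_biUnion]
      constructor
      · rintro ⟨y, hy, hp⟩
        rw [Finset.mem_product, Finset.mem_singleton, Finset.mem_range] at hp
        rw [hp.1]
        exact ⟨ht.mem_toFinset.1 hy, hp.2⟩
      · rintro ⟨hp1, hp2⟩
        refine ⟨p.1, ht.mem_toFinset.2 hp1, ?_⟩
        rw [Finset.mem_product, Finset.mem_singleton, Finset.mem_range]
        exact ⟨rfl, hp2⟩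
    have himg : Subtype.val '' A = (BF : Set (α × ℕ)) := by
      ext p
      rw [Finset.mem_coe, hmemBF]
      constructor
      · rintro ⟨i, hi, rfl⟩
        exact ⟨⟨i.2.1, hi⟩, i.2.2⟩
      · rintro ⟨hp1, hp2⟩
        exact ⟨⟨p, hp1.1, hp2⟩, hp1.2, rfl⟩
    have hAfin : A.Finite := by
      have h : (Subtype.val '' A).Finite := by rw [himg]; exact BF.finite_toSet
      exact (Set.finite_image_iff Subtype.val_injective.injOn).1 h
    have hpre : {n : ℕ | (e n).1.1 ∈ t} = e ⁻¹' A := rfl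
    refine ⟨?_, ?_⟩
    · show {n : ℕ | (e n).1.1 ∈ t}.Finite
      rw [hpre]
      exact hAfin.preimage e.injective.injOn
    · show {n : ℕ | (e n).1.1 ∈ t}.ncard = ∑ᶠ x ∈ S ∩ t, m x
      rw [hpre, Set.ncard_preimage_of_injective_subset_range e.injective
          (by rw [e.range_eq_univ]; exact Set.subset_univ _),
        ← Set.ncard_image_of_injective A Subtype.val_injective, himg, Set.ncard_coe_finset,
        hBF_def, Finset.card_biUnion, finsum_mem_eq_finite_toFinset_sum m ht]
      · refine Finset.sum_congr rfl fun x _ ↦ ?_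
        rw [Finset.card_product, Finset.card_singleton, Finset.card_range, one_mul]
      · intro x _ y _ hxy
        simp only [Function.onFun]
        rw [Finset.disjoint_left]
        rintro ⟨u, v⟩ hu hv
        rw [Finset.mem_product, Finset.mem_singleton] at hu hv
        exact hxy (hu.1.symm.trans hv.1)
  · -- (ii) summation
    intro f hf
    set a : ℂ := ∑' n, f (e n).1.1 with ha_def
    have h1 : HasSum ((fun i : I ↦ f i.1.1) ∘ e) a := hf.hasSum
    have h2 : HasSum (fun i : I ↦ f i.1.1) a := (e.hasSum_iff).1 h1
    set F : α × ℕ → ℂ := fun p ↦ f p.1 with hF_def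
    have h3 : HasSum (I.indicator F) a := hasSum_subtype_iff_indicator.1 h2
    have h4 : ∀ x : α, HasSum (fun j : ℕ ↦ I.indicator F (x, j))
        (S.indicator (fun x ↦ (m x : ℂ) * f x) x) := by
      intro x
      by_cases hx : x ∈ S
      · have hfun : (fun j : ℕ ↦ I.indicator F (x, j)) = fun j ↦ if j < m x then f x else 0 := by
          funext j
          by_cases hj : j < m x
          · rw [Set.indicator_of_mem (show (x, j) ∈ I from ⟨hx, hj⟩), if_pos hj]
          · rw [Set.indicator_of_notMem (show (x, j) ∉ I from fun h ↦ hj h.2), if_neg hj]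
        rw [hfun, Set.indicator_of_mem hx]
        have h5 : HasSum (fun j : ℕ ↦ if j < m x then f x else 0)
            (∑ j ∈ Finset.range (m x), (if j < m x then f x else 0)) :=
          hasSum_sum_of_ne_finset_zero
            (fun j hj ↦ by rw [Finset.mem_range] at hj; rw [if_neg hj])
        have h6 : (∑ j ∈ Finset.range (m x), (if j < m x then f x else (0 : ℂ))) =
            (m x : ℂ) * f x := by
          rw [Finset.sum_congr rfl (fun j hj ↦ if_pos (Finset.mem_range.1 hj)), Finset.sum_const,
            Finset.card_range, nsmul_eq_mul]
        rwa [h6] at h5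
      · have hfun : (fun j : ℕ ↦ I.indicator F (x, j)) = fun _ ↦ 0 := by
          funext j
          exact Set.indicator_of_notMem (fun h ↦ hx h.1) _
        rw [hfun, Set.indicator_of_notMem hx]
        exact hasSum_zero
    have h7 : HasSum (S.indicator fun x ↦ (m x : ℂ) * f x) a := h3.prod_fiberwise h4
    exact hasSum_subtype_iff_indicator.2 h7

end Summit.RiemannHypothesis.RiemannHypothesis.Theorems.WeilAdversary

end
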